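import Literature.NumberTheory.EllipticCurves.TianYuanZhang2017.GenusPointBlockThm35Displays
import HarnessLib

/-!
# Tian–Yuan–Zhang 2017 §3.1 / Prop. 3.2 (3): the CM-point layer of a block `d ≡ 7 (mod 8)` — `z_d ∈ A(H_d)`, `Z(d) = Σ_{t ∈ 2Cl_d} z_d^t`,
# read in an extension of `ℍ′_n` containing `H_d` — DISPLAY (one predicate, one named fact refining `tyz_genusPointBlockData`)

Companion to `GenusPointDescentDisplays.lean` (`structure GenusPointData n`; `D.H = ℍ′_n`, the genus points `D.Z d₀`), `CMPointGaloisDisplays.lean`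
(the CM-point layer of the blocks `d ≡ 5, 6 (mod 8)`: `CMBlockSpec`, (G1) "`Z(d) = Σ_{t∈Φ₀} z_d^t`", …; for `d ≡ 7 (mod 8)` ONLY `SevenBlockSpec`
= «`Z(d)` is fixed by every automorphism trivial on the genus field `L_d`») and `GenusPointBlockThm35Displays.lean` (named fact
`tyz_genusPointBlockData`).

THE GAP THIS FILE CLOSES.  For a block `d ≡ 7 (mod 8)` the source's CM point `z_d = f_d(P_d)` (`f_d = i₀ : X₀(32) → A` the identity, p0010
L38; `P_d = [h, 1] ∈ X_U(ℂ)` the CM point, p0010 L85–L88; `z_d ∈ A(K_d^{ab})`, p0010 L89) lies in `A(H_d)` (Prop. 3.2 (3): "`H′_n = H_n`", p0010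
L111; `H′_n = H_n(z_n)`, p0010 L92), and the genus point is `Z(d) := Σ_{t ∈ Φ₀} z_d^t` with `σ = 1`, `Cl′_d = Cl_d`, `Φ₀ = Φ ∩ 2Cl′_d` a set of
representatives of `(2Cl′_d)/⟨σ⟩ = 2Cl_d` (p0011 L1–L8, L53–L56) — i.e. `Φ₀ = 2Cl_d = Gal(H_d/L_d)` itself ("the genus field `L_n` is the subfield
of `H_n` fixed by `2Cl_n`", p0020 L55; "In the case `n ≡ 7 (mod 8)`, `H′_n = H_n` and thus `Z(n)` is already defined over `L_n`", p0020 L62–L63).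
Since `H_d ⊄ ℍ′_n` in general (`ℍ′_n = L_n(i)·∏_{d₀ ≡ 5,6} H′_{d₀}`, p0011 L58–L62), the package `D` (universe `A(ℍ′_n)`) could not carry `z_d`:
the tree displayed only the consequence `SevenBlockSpec`.  THIS file displays the layer itself, in an EXTENSION: **(S) there are a number field
`M ⊇ ℍ′_n` (an embedding `ι`), Galois over `ℚ`, a point `z ∈ A(M)` and a finite set `Φ ⊂ Aut_ℚ(M)` such that (S1) `ι(Z(d)) = Σ_{t∈Φ} z^t` and
`#Φ = g(d)`; (S2) no `z^t` (`t ∈ Φ`) lies in `A[(1+i)³]` (the cusps: "`i₀` identifies the set of cusps with `A[(1+i)³] = A(ℚ(i))`", p0012 L8–L9;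
`P_d^t` are CM points, not cusps; `A[(1+i)³] = {Q : 2·2Q = 0, 2Q ∈ {0, τ(1)}}`, Lemma 3.16); (S3) every `g ∈ Aut_ℚ(M)` trivial on `ι(L_d(i))`
PERMUTES the points `z^t`, `t ∈ Φ`** — the Galois-theoretic content of «`z_d ∈ A(H_d)`, `H_d/ℚ` Galois, `Φ₀ = 2Cl_d = Gal(H_d/L_d)` a group,
`H_d ∩ L_d(i) ⊇ L_d`»: `g|_{H_d} ∈ Gal(H_d/L_d) = 2Cl_d`, so `g·z^t = z^{(g|_{H_d})t}` and `t ↦ (g|_{H_d})t` is a bijection of `2Cl_d`.  (Taking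
`M = ℍ′_n·H_d ⊂ ℚ̄`, `ι` the inclusion, `z = z_d`, `Φ` = lifts of `2Cl_d`, (S1)–(S3) are the quoted sentences.)  ONE named fact
`tyz_sevenBlockCMData` asserts that TYZ's data satisfy `Printed ∧ CMPointCompositumPrinted ∧ Thm35AtBlocks ∧ (S) at every block d ≡ 7` — it refines
`tyz_genusPointBlockData` (§4).

WHY (consumer).  The LEAD lineage of crux stmt-BirchSwinnertonDyer-20509 reduced C⁺ on the sector R2 (`n = lq ≡ 7 (mod 8)`) to laws about the
`2`-adic depth of `Z(lq)` in `A(ℍ′_{lq})/tors` (`Summits/…/Theorems/PrintCf2RamifiedOffTYZGenusPeriodR2.lean`, p789339); its U-road (cycle 20 memo §4;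
bricks `Literature/…/TwoDescentGaloisNormProofs.lean`, `…/TwoDescentCyclicTraceProofs.lean`, p782639/p782927) computes the `2`-descent (Kummer)
classes of a Galois TRACE as NORMS — and needs exactly (S1)–(S3) to see `Z(lq)` as a trace.  Typed by the LEAD (cruxlead-20509 g26) as the input
"(U0)" named in HOME/HANDOFF §§ cruxlead g24/g25.

HONEST FRAMING: §1–§3 are a display (one predicate for three printed sentences, read on named objects in an extension field) and ONE named fact;
nothing in §1–§3 is asserted (no `_holds`), no count moves; consumers take `(h : tyz_sevenBlockCMData)` as an explicit hypothesis.  NOT displayed: the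
explicit embedding `K_d → M₂(ℚ)` / `δ` (p0010 L44–L46), Thm. 3.6 (3) (`z̄_n + z_n^{σ_{ϖ⁵}} = τ(½)`), Prop. 3.2 (4) (`2z_n ∈ A(H_n)`), that the `z^t`
are pairwise distinct, any class-number VALUE.  Net debt of this file: +1 (a display; no research content).  Cell `bsd-print-cf2`, LEAD seat
cruxlead-20509 g26.  BSD is not proved by any of this; no class is closed by this file.

References: [TianYuanZhang2017] Y. Tian, X. Yuan, S.-W. Zhang, *Genus periods, genus points and congruent number problem*, Asian J. Math. 21 (2017)
721–774 = arXiv:1411.4728: §3.1 (chunk p0010 L36–L46, L85–L92, L111; p0011 L1–L8, L53–L66), §3.2 (p0012 L8–L9), Lemma 3.16 (p0017 L98–L101), proof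
of Lemma 3.21 (p0020 L50–L63); D. A. Cox, *Primes of the form x² + ny²* (2nd ed.), Thm. 6.1 (genus field), Lemma 9.3 (ring class fields Galois over
`ℚ`) [Cox2013].
-/

noncomputable section

open scoped Classical

open WeierstrassCurve

namespace Literature.NumberTheory.EllipticCurves.TianYuanZhang2017

namespace GenusPointData

variable {n : ℕ}

/-! ## §1 Vocabulary in an extension `M` of `ℍ′_n` -/

/-- `g ∈ Aut_ℚ(M)` acting on `A(M)` (the paper's `R ↦ R^g`; `Affine.Point.map`, as `galPt` for `M = ℍ′_n`).
[cite: TianYuanZhang2017, §3.1 (p0011 L53–L58: Z(n) := Σ_{t∈Φ₀} f_n(P_n)^t)] -/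
def galPtOver (M : Type) [Field M] [CharZero M] (g : M ≃ₐ[ℚ] M) : APoint M →+ APoint M :=
  WeierstrassCurve.Affine.Point.map (W' := curveA) g.toAlgHom

/-- «`g ∈ Aut_ℚ(M)` is trivial on (the image of) `L_d(i) = ℚ(i, √d′ : d′ ∣ d)`» — `g` fixes `ι(i)` and `ι(√−d′)` for the divisors `1 < d′` of
`d` (the transport of `TrivialOnL` along `ι : ℍ′_n → M`). [cite: TianYuanZhang2017, proof of Lemma 3.21 (p0020 L55–L58: "L_n(i) = ℚ(i, √d : d ∣ n)")] -/
def TrivialOnLOver (D : GenusPointData n) {M : Type} [Field M] [CharZero M] (ι : D.H →ₐ[ℚ] M) (d : ℕ)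
    (g : M ≃ₐ[ℚ] M) : Prop :=
  g (ι D.im) = ι D.im ∧ ∀ d' ∈ d.divisors, 1 < d' → g (ι (D.sqrtNeg d')) = ι (D.sqrtNeg d')

/-! ## §2 The printed sentences for a block `d ≡ 7 (mod 8)`, read in an extension `M ⊇ ℍ′_n` -/

/-- **(S) The CM-point layer of a block `d ≡ 7 (mod 8)`** (module docstring): there are a number field `M`, Galois over `ℚ`, an embedding
`ι : ℍ′_n → M`, a point `z ∈ A(M)` (`z_d = i₀(P_d) ∈ A(H_d)`, `H′_d = H_d`) and a finite set `Φ ⊂ Aut_ℚ(M)` (lifts of `Φ₀ = 2Cl_d = Gal(H_d/L_d)`) with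
(S1) `ι(Z(d)) = Σ_{t∈Φ} z^t` and `#Φ = g(d)`; (S2) no `z^t` is a cusp (`∉ A[(1+i)³]`); (S3) every automorphism of `M` trivial on `ι(L_d(i))` permutes
the `z^t`, `t ∈ Φ`.  A predicate; nothing asserted.
[cite: TianYuanZhang2017, §3.1 (p0010 L38, L85–L92, L111; p0011 L1–L8, L53–L56), §3.2 (p0012 L8–L9), Lemma 3.16 (p0017 L98–L101), proof of Lemma 3.21 (p0020 L55–L63)]
[cite: Cox2013, Thm. 6.1 and Lemma 9.3] -/
def SevenBlockCMSpec (D : GenusPointData n) (d : ℕ) : Prop :=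
  ∃ (M : Type) (_ : Field M) (_ : NumberField M) (_ : IsGalois ℚ M) (ι : D.H →ₐ[ℚ] M) (z : APoint M) (Φ : Finset (M ≃ₐ[ℚ] M)),
    -- (S1) "Z(n) := Σ_{t∈Φ₀} f_n(P_n)^t", "Φ₀ ... a set of representatives of 2Cl_n" (σ = 1), "#Φ₀ = g(n)"
    (WeierstrassCurve.Affine.Point.map (W' := curveA) ι (D.Z d) = ∑ t ∈ Φ, galPtOver M t z ∧ Φ.card = gK d) ∧
    -- (S2) the P_n^t are CM points of X_U, NOT cusps; "i₀ identifies the set of cusps with A[(1+i)³]"; A[(1+i)³] = {Q : 2Q ∈ {0, τ(1)}}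
    (∀ t ∈ Φ, ¬ ((2 : ℕ) • galPtOver M t z = 0 ∨ (2 : ℕ) • galPtOver M t z = tauOne)) ∧
    -- (S3) "z_n ∈ A(H_n)" (H′_n = H_n), H_n/ℚ Galois, Φ₀ = 2Cl_n = Gal(H_n/L_n) a group: automorphisms trivial on L_d(i) permute the z^t
    (∀ g : M ≃ₐ[ℚ] M, D.TrivialOnLOver ι d g →
      ∃ π : Φ → Φ, Function.Bijective π ∧ ∀ t : Φ, galPtOver M g (galPtOver M (t : M ≃ₐ[ℚ] M) z) = galPtOver M (π t : M ≃ₐ[ℚ] M) z)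

/-- **(S) at every block `d ∣ n`, `d ≡ 7 (mod 8)`.**  A predicate; nothing asserted.
[cite: TianYuanZhang2017, §3.1 (p0011 L53–L66), Prop. 3.2 (3) (p0010 L111)] -/
def SevenBlockCMPrinted (D : GenusPointData n) : Prop :=
  ∀ d ∈ n.divisors, d % 8 = 7 → D.SevenBlockCMSpec d

end GenusPointData

/-! ## §3 The ONE named fact -/

/-- **Tian–Yuan–Zhang 2017, §3 with the CM-point layer of ALL blocks (including `d ≡ 7 (mod 8)`, read in an extension of `ℍ′_n`), the compositum
sentence, Theorem 3.5 at the blocks, AS PRINTED, as ONE named fact**: for every positive square-free `n ≡ 5, 6, 7 (mod 8)` there are data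
`D : GenusPointData n` satisfying `Printed`, `CMPointCompositumPrinted`, `Thm35AtBlocks` and `SevenBlockCMPrinted`.  Constructed in the source from
the CM points on `X_U → A` (§3.1–3.2), Yuan–Zhang–Zhang's Gross–Zagier formula (Thm. 3.3) and class field theory; no `_holds` expected.  Refines
`tyz_genusPointBlockData` (§4).  Consumers take it as an explicit hypothesis; nothing is asserted here.
[cite: TianYuanZhang2017, §3: §3.1 (p0010 L36–L115, p0011 L1–L73), Prop. 3.2 (3), Prop. 3.4, Thm. 3.5, Thm. 3.6, Lemma 3.16, Lemma 3.18, Lemma 3.21 and its proof (p0020 L50–L63)]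
[cite: Cox2013, Thm. 6.1 and Lemma 9.3] -/
def tyz_sevenBlockCMData : Prop :=
  ∀ (n : ℕ), Squarefree n → (n % 8 = 5 ∨ n % 8 = 6 ∨ n % 8 = 7) →
    ∃ D : GenusPointData n, D.Printed ∧ D.CMPointCompositumPrinted ∧ D.Thm35AtBlocks ∧ D.SevenBlockCMPrinted

/-! ## §4 Proved consequences: the refinement; no `z^t` is `O` -/

/-- `tyz_sevenBlockCMData ⟹ tyz_genusPointBlockData` (drop (S)). [cite: TianYuanZhang2017, §3.1, Thm. 3.5] -/
theorem tyz_genusPointBlockData_of_sevenBlockCMData (h : tyz_sevenBlockCMData) : tyz_genusPointBlockData :=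
  fun n hsq h8 => by
    obtain ⟨D, hP, hC, hB, -⟩ := h n hsq h8
    exact ⟨D, hP, hC, hB⟩

namespace GenusPointData

variable {n : ℕ}

/-- No `z^t` is `O`: each is an affine point (from (S2): `O ∈ A[(1+i)³]`). [cite: TianYuanZhang2017, §3.2 (p0012 L8–L9), Lemma 3.16] -/
theorem galPtOver_ne_zero_of_not_cusp {M : Type} [Field M] [NumberField M] {z : APoint M} {Φ : Finset (M ≃ₐ[ℚ] M)}
    (h2 : ∀ t ∈ Φ, ¬ ((2 : ℕ) • galPtOver M t z = 0 ∨ (2 : ℕ) • galPtOver M t z = tauOne)) {t : M ≃ₐ[ℚ] M} (ht : t ∈ Φ) :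
    galPtOver M t z ≠ 0 := fun h0 => h2 t ht (Or.inl (by rw [h0, smul_zero]))

end GenusPointData

end Literature.NumberTheory.EllipticCurves.TianYuanZhang2017

end
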